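import Summits.CriticalPhenomena.CardyFormulaZ2.Theorems.CardySelfDualSegmentUniformMarginalityDefs

/-!
# Vocabulary of the line `pivotal-balance-heat-flow` for the crux `UniformMarginality`, part 2
(stmt-CriticalPhenomena-5472, route `CardySelfDualSegment`)

Second definitions-only support file of the lead's skeleton `Cruxes/UniformMarginality/Lines/Sketch.lean`
(the first, `CardySelfDualSegmentUniformMarginalityDefs.lean`, is at the 400-line cap). It carries the
EAST-edge twin of the Russo integrand and three further statements POSITED BY THE LINE (sub-goals of the
diagnostic identity "pivotal balance"; not literature facts, never relocated):

* `russoIntegrandEast A v ω = (1 − 2·𝟙{N_v ∈ ω}) · 𝟙{E_v pivotal}` — the roles of the east and north edge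
  of the corner at `v` exchanged (the corner law `(½−t/4 | t/4 ; t/4 | ½−t/4)` is symmetric in them);
* `RussoIdentityEast` (R_E): `∂_t P_t(R,δ) = ½ Σ_v E_t[(1 − 2 n_v) 𝟙{E_v pivotal}]` — the regrouping
  of the Hessian form `∂_t P_t = ¼ Σ_v [F_v(10) − F_v(11) + F_v(01) − F_v(00)]` of `RussoIdentity` (R);
* `HeatFlowBalance` (HF): for every vertex, `E_t[𝟙{N_v piv}(1 − 2·𝟙_A)] = (1 − t) E_t[(1 − 2c_v)𝟙{N_v piv}]`
  and `E_t[𝟙{E_v piv}(1 − 2·𝟙_A)] = (1 − t) E_t[(1 − 2n_v)𝟙{E_v piv}]` (on `{e pivotal}` the increasing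
  event `A` holds iff `e` is open, and `P_t(N_v open | c_v) = (1 − t/2)c_v + (t/2)(1 − c_v)`, resp. the same
  with `E`, `N` exchanged);
* `PivotalBalanceLattice` (PB): `E_t[#Piv ; Aᶜ] − E_t[#Piv ; A] = 4 (1 − t) ∂_t P_t(R,δ)`, where `#Piv`
  counts the pivotal LATTICE edges, each lattice edge being the north or the east edge of exactly one
  vertex: (PB) = Σ_v (HF) fed with (R) and (R_E).

CORRECTION recorded here (append-only tree): the statement `PivotalBalance` of the first Defs file counts
`pivotals (crossEvent R δ) ω` over ALL unordered pairs of vertices — and for the crude event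
(`openGraph ω = SimpleGraph.fromEdgeSet ω`, no lattice restriction) a NON-lattice pair `s(a,b)`, `a, b`
far apart, is pivotal on `Aᶜ` whenever its hypothetical insertion would join the two sides; such
"teleport pairs" are never open under `M_t` but they are counted by `pivCountIn K` once `K ⊇ pivotals`.
Hence `PivotalBalance` as typed there carries the extra non-negative term `E_t[#Piv_teleport ; Aᶜ]` on its
left side and is NOT the intended identity (expected false already on small boxes); it is superseded by
`PivotalBalanceLattice` below and is used by nothing.
-/

noncomputable section

namespace Summit.CriticalPhenomena.CardyFormulaZ2.Cruxes.UniformMarginality.HeatFlow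

open MeasureTheory Literature.Probability.Percolation Literature.Probability.LatticeModels
  Literature.Probability.RandomPlanarGeometry
open scoped Classical

/-- East twin of the Russo integrand at the vertex `v`:
`X^E_v(ω) = (1 − 2·𝟙{N_v ∈ ω}) · 𝟙{E_v pivotal for A in ω}`. -/
def russoIntegrandEast (A : Set (BondConfig (Site 2))) (v : Site 2) (ω : BondConfig (Site 2)) : ℝ :=
  (if northEdge v ∈ ω then (-1 : ℝ) else 1) * (if IsPivotal A (eastEdge v) ω then 1 else 0)

/-- SUB-GOAL (R_E) — **east twin of the Russo identity**: for `δ > 0` there is a finite set `K` of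
vertices outside which no east edge is ever pivotal for the crude crossing event, and
`∂_t P_t(R,δ) = ½ Σ_{v ∈ K} E_t[(1 − 2 n_v) 𝟙{E_v pivotal}]` at every `t ∈ (0,1)`
(`n_v = 𝟙{N_v open}`; same derivative as (R): both are regroupings of the Hessian form). -/
def RussoIdentityEast : Prop :=
  ∀ (R : ConformalRectangle) (δ : ℝ), 0 < δ → ∃ K : Finset (Site 2),
    (∀ ω, ∀ v ∉ K, ¬ IsPivotal (crossEvent R δ) (eastEdge v) ω) ∧
    ∀ t ∈ Set.Ioo (0 : ℝ) 1,
      HasDerivAt (Pext R δ)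
        ((1 / 2 : ℝ) * ∑ v ∈ K, ∫ ω, russoIntegrandEast (crossEvent R δ) v ω ∂(M t)) t

/-- SUB-GOAL (HF) — **heat-flow balance at one corner**: for every vertex `v`, `δ > 0` and
`t ∈ (0,1)`, `E_t[𝟙{N_v piv}·(1 − 2·𝟙_A)] = (1 − t)·E_t[(1 − 2 c_v) 𝟙{N_v piv}]` and
`E_t[𝟙{E_v piv}·(1 − 2·𝟙_A)] = (1 − t)·E_t[(1 − 2 n_v) 𝟙{E_v piv}]` (on `{e pivotal}` the
increasing event `A = crossEvent R δ` holds iff `e` is open; the conditional law of the north bit given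
the coin is `P_t(N_v open | c_v) = (1 − t/2) c_v + (t/2)(1 − c_v)`, and symmetrically with `E`, `N`
exchanged). -/
def HeatFlowBalance : Prop :=
  ∀ (R : ConformalRectangle) (δ : ℝ), 0 < δ → ∀ (v : Site 2), ∀ t ∈ Set.Ioo (0 : ℝ) 1,
    (∫ ω, (if IsPivotal (crossEvent R δ) (northEdge v) ω then (1 : ℝ) else 0) *
        (if ω ∈ crossEvent R δ then (-1 : ℝ) else 1) ∂(M t)
      = (1 - t) * ∫ ω, russoIntegrand (crossEvent R δ) v ω ∂(M t)) ∧
    (∫ ω, (if IsPivotal (crossEvent R δ) (eastEdge v) ω then (1 : ℝ) else 0) *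
        (if ω ∈ crossEvent R δ then (-1 : ℝ) else 1) ∂(M t)
      = (1 - t) * ∫ ω, russoIntegrandEast (crossEvent R δ) v ω ∂(M t))

/-- The number of pivotal LATTICE edges of `A` in `ω` indexed by the vertices of `K`: each lattice
edge is the north or the east edge of exactly one vertex. -/
def latticePivCount (K : Finset (Site 2)) (A : Set (BondConfig (Site 2))) (ω : BondConfig (Site 2)) : ℝ :=
  ∑ v ∈ K, ((if IsPivotal A (northEdge v) ω then (1 : ℝ) else 0) +
    (if IsPivotal A (eastEdge v) ω then (1 : ℝ) else 0))

/-- DIAGNOSTIC IDENTITY of the line, corrected form — **pivotal balance over lattice edges** (PB):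
for `δ > 0` there is a finite set `K` of vertices carrying every pivotal north/east edge, and for all
`t ∈ (0,1)`, `E_t[#Piv ; Aᶜ] − E_t[#Piv ; A] = 4 (1 − t) ∂_t P_t(R,δ)` with `#Piv` the number of
pivotal lattice edges. ((PB) = Σ_v (HF) with (R) and (R_E).) Supersedes `PivotalBalance` of the first
Defs file (see the module docstring). -/
def PivotalBalanceLattice : Prop :=
  ∀ (R : ConformalRectangle) (δ : ℝ), 0 < δ → ∃ K : Finset (Site 2),
    (∀ ω, ∀ v ∉ K, ¬ IsPivotal (crossEvent R δ) (northEdge v) ω ∧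
      ¬ IsPivotal (crossEvent R δ) (eastEdge v) ω) ∧
    ∀ t ∈ Set.Ioo (0 : ℝ) 1,
      ∫ ω, latticePivCount K (crossEvent R δ) ω *
          (if ω ∈ crossEvent R δ then (-1 : ℝ) else 1) ∂(M t)
        = 4 * (1 - t) * deriv (Pext R δ) t

end Summit.CriticalPhenomena.CardyFormulaZ2.Cruxes.UniformMarginality.HeatFlow

end

namespace Summit.CriticalPhenomena.CardyFormulaZ2.Cruxes.UniformMarginality.HeatFlow

open MeasureTheory Literature.Probability.Percolation Literature.Probability.LatticeModels
  Literature.Probability.RandomPlanarGeometry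

/-- **Assembly of (PB) from (R), (R_E), (HF)** (proved glue): the corrected pivotal balance follows
from the two Russo identities and the one-corner heat-flow balances, with `K` the union of the two
finite vertex sets. -/
theorem pivotalBalanceLattice_of :
    RussoIdentity → RussoIdentityEast → HeatFlowBalance → PivotalBalanceLattice := by
  classical
  intro hR hE hH R δ hδ
  obtain ⟨K₁, hK₁, hd₁⟩ := hR R δ hδ
  obtain ⟨K₂, hK₂, hd₂⟩ := hE R δ hδ
  refine ⟨K₁ ∪ K₂, fun ω v hv => ?_, fun t ht => ?_⟩
  · rw [Finset.mem_union, not_or] at hv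
    exact ⟨hK₁ ω v hv.1, hK₂ ω v hv.2⟩
  -- both Russo sums extend to `K₁ ∪ K₂` (the added terms vanish) and equal `2 ∂_t P_t`
  set A := crossEvent R δ with hA
  have hXN : ∀ v ∉ K₁, ∫ ω, russoIntegrand A v ω ∂(M t) = 0 := by
    intro v hv
    have h0 : ∀ ω, russoIntegrand A v ω = 0 := fun ω => by
      unfold russoIntegrand; rw [if_neg (hK₁ ω v hv), mul_zero]
    simp [h0]
  have hXE : ∀ v ∉ K₂, ∫ ω, russoIntegrandEast A v ω ∂(M t) = 0 := by
    intro v hv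
    have h0 : ∀ ω, russoIntegrandEast A v ω = 0 := fun ω => by
      unfold russoIntegrandEast; rw [if_neg (hK₂ ω v hv), mul_zero]
    simp [h0]
  have hsumN : ∑ v ∈ K₁ ∪ K₂, ∫ ω, russoIntegrand A v ω ∂(M t) =
      ∑ v ∈ K₁, ∫ ω, russoIntegrand A v ω ∂(M t) := by
    symm
    refine Finset.sum_subset Finset.subset_union_left fun v _ hv => hXN v hv
  have hsumE : ∑ v ∈ K₁ ∪ K₂, ∫ ω, russoIntegrandEast A v ω ∂(M t) =
      ∑ v ∈ K₂, ∫ ω, russoIntegrandEast A v ω ∂(M t) := by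
    symm
    refine Finset.sum_subset Finset.subset_union_right fun v _ hv => hXE v hv
  have hderivN : deriv (Pext R δ) t = (1 / 2 : ℝ) * ∑ v ∈ K₁, ∫ ω, russoIntegrand A v ω ∂(M t) :=
    (hd₁ t ht).deriv
  have hderivE : deriv (Pext R δ) t =
      (1 / 2 : ℝ) * ∑ v ∈ K₂, ∫ ω, russoIntegrandEast A v ω ∂(M t) :=
    (hd₂ t ht).deriv
  -- integrability of the bounded measurable summands is not needed: we rewrite the integral of the
  -- finite sum as the finite sum of integrals through (HF), which is stated per vertex
  have hHF := fun v => hH R δ hδ v t ht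
  -- expand `latticePivCount` and distribute
  have hpt : ∀ ω, latticePivCount (K₁ ∪ K₂) A ω * (if ω ∈ A then (-1 : ℝ) else 1) =
      ∑ v ∈ K₁ ∪ K₂, ((if IsPivotal A (northEdge v) ω then (1 : ℝ) else 0) *
          (if ω ∈ A then (-1 : ℝ) else 1) +
        (if IsPivotal A (eastEdge v) ω then (1 : ℝ) else 0) *
          (if ω ∈ A then (-1 : ℝ) else 1)) := by
    intro ω
    unfold latticePivCount
    rw [Finset.sum_mul]
    refine Finset.sum_congr rfl fun v _ => ?_
    ring
  simp_rw [hpt]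
  -- each summand is integrable (bounded by 1 in modulus, `M t` a probability measure)
  haveI : IsProbabilityMeasure (M t) := by unfold M; infer_instance
  have hmeasA : MeasurableSet A := measurableSet_crossEvent R δ
  have hint : ∀ (e : Sym2 (Site 2)), Integrable (fun ω : BondConfig (Site 2) =>
      (if IsPivotal A e ω then (1 : ℝ) else 0) * (if ω ∈ A then (-1 : ℝ) else 1)) (M t) := by
    intro e
    refine Integrable.of_bound (C := 1) ?_ (Filter.Eventually.of_forall fun ω => ?_)
    · refine Measurable.aestronglyMeasurable ?_
      refine Measurable.mul ?_ ?_
      · refine Measurable.ite ?_ measurable_const measurable_const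
        -- `{ω | IsPivotal A e ω}` is measurable
        have h1 : Measurable fun ω : BondConfig (Site 2) => insert e ω :=
          measurable_set_iff.2 fun f => by
            by_cases hf : f = e
            · subst hf; simp only [Set.mem_insert_iff, true_or]; exact measurable_const
            · simp only [Set.mem_insert_iff, hf, false_or]; exact measurable_set_mem f
        have h2 : Measurable fun ω : BondConfig (Site 2) => ω \ {e} :=
          measurable_set_iff.2 fun f => by
            by_cases hf : f = e
            · subst hf; simp only [Set.mem_sdiff, Set.mem_singleton_iff, not_true, and_false]
              exact measurable_const
            · simp only [Set.mem_sdiff, Set.mem_singleton_iff, hf, not_false_eq_true, and_true]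
              exact measurable_set_mem f
        have : {ω : BondConfig (Site 2) | IsPivotal A e ω} =
            ((insert e) ⁻¹' A ∩ ((· \ {e}) ⁻¹' A)ᶜ) ∪ (((· \ {e}) ⁻¹' A) ∩ ((insert e) ⁻¹' A)ᶜ) := by
          ext ω; simp only [IsPivotal, Xor, Set.mem_setOf_eq, Set.mem_union, Set.mem_inter_iff,
            Set.mem_compl_iff, Set.mem_preimage]
        rw [this]
        exact ((h1 hmeasA).inter (h2 hmeasA).compl).union ((h2 hmeasA).inter (h1 hmeasA).compl)
      · exact Measurable.ite hmeasA measurable_const measurable_const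
    · rw [Real.norm_eq_abs, abs_mul]
      refine mul_le_one₀ ?_ (abs_nonneg _) ?_ <;> split_ifs <;> simp
  have hF : ∀ v ∈ K₁ ∪ K₂, Integrable (fun ω : BondConfig (Site 2) =>
      (if IsPivotal A (northEdge v) ω then (1 : ℝ) else 0) * (if ω ∈ A then (-1 : ℝ) else 1) +
        (if IsPivotal A (eastEdge v) ω then (1 : ℝ) else 0) * (if ω ∈ A then (-1 : ℝ) else 1)) (M t) :=
    fun v _ => (hint (northEdge v)).add (hint (eastEdge v))
  rw [integral_finsetSum (K₁ ∪ K₂) (f := fun v (ω : BondConfig (Site 2)) =>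
      (if IsPivotal A (northEdge v) ω then (1 : ℝ) else 0) * (if ω ∈ A then (-1 : ℝ) else 1) +
        (if IsPivotal A (eastEdge v) ω then (1 : ℝ) else 0) * (if ω ∈ A then (-1 : ℝ) else 1)) hF]
  rw [Finset.sum_congr rfl fun v _ => integral_add (hint (northEdge v)) (hint (eastEdge v)),
    Finset.sum_add_distrib]
  have h1 : ∑ v ∈ K₁ ∪ K₂, ∫ ω, (if IsPivotal A (northEdge v) ω then (1 : ℝ) else 0) *
      (if ω ∈ A then (-1 : ℝ) else 1) ∂(M t) = (1 - t) * (2 * deriv (Pext R δ) t) := by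
    rw [hderivN, show (1 - t) * (2 * ((1 / 2 : ℝ) * ∑ v ∈ K₁, ∫ ω, russoIntegrand A v ω ∂(M t))) =
      (1 - t) * ∑ v ∈ K₁, ∫ ω, russoIntegrand A v ω ∂(M t) by ring, ← hsumN, Finset.mul_sum]
    exact Finset.sum_congr rfl fun v _ => (hHF v).1
  have h2 : ∑ v ∈ K₁ ∪ K₂, ∫ ω, (if IsPivotal A (eastEdge v) ω then (1 : ℝ) else 0) *
      (if ω ∈ A then (-1 : ℝ) else 1) ∂(M t) = (1 - t) * (2 * deriv (Pext R δ) t) := by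
    rw [hderivE, show (1 - t) * (2 * ((1 / 2 : ℝ) * ∑ v ∈ K₂, ∫ ω, russoIntegrandEast A v ω ∂(M t))) =
      (1 - t) * ∑ v ∈ K₂, ∫ ω, russoIntegrandEast A v ω ∂(M t) by ring, ← hsumE, Finset.mul_sum]
    exact Finset.sum_congr rfl fun v _ => (hHF v).2
  rw [h1, h2]
  ring

end Summit.CriticalPhenomena.CardyFormulaZ2.Cruxes.UniformMarginality.HeatFlow
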